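import Mathlib
import HarnessLib
import Literature.Combinatorics.Additive.QuasiProgressions

/-!
# Grynkiewicz 2009, Corollary 4.2, first assertion: for a non-extendible pair with
# `|A + B| = |A| + |B|`, a critical one-point extension `(A ∪ {α}) + (B ∪ {β})` is aperiodic

[cite: Grynkiewicz2009, Cor 4.2 (first assertion) and its proof, pp. 11–12] [tag: critical-pair] [tag: inverse-theorem]

Topic `Literature/Combinatorics/Additive`.  Cell `mm-stpp` (D-0046), seat `mm-stpp-lit` (gen 24); the
port of D. J. Grynkiewicz, *A step beyond Kemperman's structure theorem*, Mathematika **55** (2009)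
67–114 continued.  Corollary 4.2 (print p. 11): «Let `A` and `B` be finite, nonempty subsets of an
abelian group `G` with `|A + B| = |A| + |B|`, and suppose that (17) holds.  Let `A′ = A ∪ {α}` and let
`B′ = B ∪ {β}`.  If `(A, B)` is non-extendible, then `A′ + B′` cannot be periodic without a unique
expression element.  Hence let … be the Kemperman decompositions with common quasi-period `H`.
Furthermore, one of the following must also hold: (A) … (B) … (C) …».  This file proves the FIRST
ASSERTION (the one the proof of Theorem 4.1 uses, in Claim 9, p. 28, to apply KST to the extended pair);
the trichotomy (A)/(B)/(C) is not transcribed.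

THE PRINTED PROOF (p. 11 bottom, p. 12 «Next suppose `A′ + B′` is periodic without a unique expression
element …») and how it is mirrored.
* «Since `(A, B)` is non-extendible and (17) holds, it follows that `(A′ + B′) ∖ γ = A + B`, with
  `γ ∈ A′ + B′`» — `notMem_of_seventeen` (`α ∉ A`, `β ∉ B`) and `exists_insert_eq_of_seventeen`.
* «Thus `(A + B) ∪ {γ}` is periodic with maximal period (say) `K`, and there are exactly `|K| + 1` holes in
  `A` and `B`» — with `K = H(A′ + B′)`: Kneser's theorem gives `|A′ + K| + |B′ + K| ≤ |A′ + B′| + |K|`,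
  and divisibility by `|K|` forces equality (`card_add_addStab_add_eq`), i.e. `|K| − 1` holes in `A′`
  and `B′`; the cosets `α + K`, `β + K` still meet `A`, `B` (`add_addStab_eq_insert_add`: otherwise the
  other side is `K`-periodic and extendible), whence `|K| + 1` holes in `A` and `B`.
* «Since `γ ∉ A + B`, it follows in view of Proposition 2.1 applied with `G = K` that there must exist
  `a₀ ∈ A` and `b₀ ∈ B` such that `A_{a₀}` and `B_{b₀}` contain at least `|K|` holes with
  `γ ∈ A_{a₀} + B_{b₀} + K`» — `mem_add_of_card_lt` (Prop 2.1 (i) inside a pair of `K`-cosets).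
* «Thus if the last remaining hole is not also in either `A_{a₀}` or `B_{b₀}`, then adding it to either
  `A` or `B` will contradict the non-extendibility of `(A, B)`» — `false_of_hole_outside`.
* «Hence `|A_{a₀}| + |B_{b₀}| = |K| − 1, whence the arguments used in the previous paragraph for type (III)
  show that the pair `(A, B)` is extendible» (p. 12, type (III): «there are exactly `|H| − |B₀|` elements
  `x ∈ A₀ + H` such that `γ ∉ x + B₀`.  Since `|A₀| < |H| − |B₀|` … adding `x` contradicts the
  non-extendibility of `(A, B)`») — `false_of_slices_small`.

SCOPE REMARK (recorded, not editorialised).  The printed argument never uses the clause «without a unique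
expression element»: it derives a contradiction from the periodicity of `A′ + B′` alone (the hole count,
Proposition 2.1 and the two extendibility constructions above use only `K = H(A′ + B′) ≠ 0`).  We
therefore state the conclusion as printed-proof-strength APERIODICITY, `(A′ + B′).addStab = {0}`
(`addStab_insert_add_insert_eq`), and derive the printed wording — in the form of the KST hypothesis of
the tree's `exists_isKempermanDecompI`, «`A′ + B′` aperiodic or with a unique expression element» — as
`not_isPeriodic_or_exists_unique_of_seventeen`.  (Sanity check of the stronger reading, not part of the
proof: exhaustive search over all non-extendible pairs in `ℤ/n`, `n ≤ 12`, `ℤ/2 × ℤ/4`, `ℤ/3 × ℤ/3`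
found no periodic critical extension; seat log 2026-08-29.)

WHAT THIS FILE IS NOT: no new definitions, no named facts; the second part of Corollary 4.2 ((A)–(C)),
Corollaries 4.3–4.4 and Claim 9 itself are not here.

## References
* D. J. Grynkiewicz, *A step beyond Kemperman's structure theorem*, Mathematika 55 (2009) 67–114,
  doi:10.1112/S0025579300000966; §4, Corollary 4.2 and its proof (pp. 11–12), §2 Proposition 2.1,
  §6 Claim 9 (p. 28, the use) (held `paper:doi-10-1112-s0025579300000966`, pp. 11–12, 28 read
  2026-08-29) [cite: Grynkiewicz2009, Cor 4.2].
* M. Kneser, *Abschätzungen der asymptotischen Dichte von Summenmengen*, Math. Z. 58 (1953) 459–484 —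
  the tree's `add_kneser` [cite: Kneser1953].
-/

namespace Literature.Combinatorics.Additive.Grynkiewicz2009

open Finset
open scoped Pointwise

variable {G : Type*} [AddCommGroup G] [DecidableEq G]

/-! ### (17) for a non-extendible pair: `α ∉ A`, `β ∉ B`, `A′ + B′ = (A + B) ∪ {γ}` -/

/-- For a non-extendible pair with `|A + B| = |A| + |B|`, display (17)
`|(A ∪ {α}) + (B ∪ {β})| = |A ∪ {α}| + |B ∪ {β}| − 1` forces `α ∉ A` and `β ∉ B` (if, say, `α ∈ A`,
then `A + (B ∪ {β}) = A + B` by counting, contradicting the non-extendibility of `B`).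
[cite: Grynkiewicz2009, Cor 4.2 (proof, first sentence)] -/
theorem notMem_of_seventeen {A B : Finset G} {α β : G} (hAB : #(A + B) = #A + #B)
    (hneA : IsNonExtendible A B) (hneB : IsNonExtendible B A)
    (h17 : #(insert α A + insert β B) + 1 = #(insert α A) + #(insert β B)) : α ∉ A ∧ β ∉ B := by
  have key : ∀ {A B : Finset G} {α β : G}, #(A + B) = #A + #B → IsNonExtendible B A →
      #(insert α A + insert β B) + 1 = #(insert α A) + #(insert β B) → α ∉ A := by
    intro A B α β hAB hneB h17 hα
    rw [insert_eq_of_mem hα] at h17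
    by_cases hβ : β ∈ B
    · rw [insert_eq_of_mem hβ] at h17
      omega
    · rw [card_insert_of_notMem hβ] at h17
      apply hneB β hβ
      refine (eq_of_subset_of_card_le (add_subset_add_right (subset_insert β B)) ?_).symm
      rw [add_comm (insert β B) A, add_comm B A]
      omega
  refine ⟨key hAB hneB h17,
    key (A := B) (B := A) (α := β) (β := α) (by rw [add_comm, hAB, add_comm]) hneA ?_⟩
  rw [add_comm (insert β B), h17, add_comm]

/-- «Since `(A, B)` is non-extendible and (17) holds, it follows that `(A′ + B′) ∖ γ = A + B`, with
`γ ∈ A′ + B′`»: `A′ + B′ = (A + B) ∪ {γ}` for some `γ ∉ A + B`.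
[cite: Grynkiewicz2009, Cor 4.2 (proof, first sentence)] -/
theorem exists_insert_eq_of_seventeen {A B : Finset G} {α β : G} (hAB : #(A + B) = #A + #B)
    (hα : α ∉ A) (hβ : β ∉ B)
    (h17 : #(insert α A + insert β B) + 1 = #(insert α A) + #(insert β B)) :
    ∃ γ, γ ∉ A + B ∧ insert α A + insert β B = insert γ (A + B) := by
  rw [card_insert_of_notMem hα, card_insert_of_notMem hβ] at h17
  have hsub : A + B ⊆ insert α A + insert β B :=
    add_subset_add (subset_insert α A) (subset_insert β B)
  have hcard : #((insert α A + insert β B) \ (A + B)) = 1 := by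
    rw [card_sdiff_of_subset hsub]
    omega
  obtain ⟨γ, hγ⟩ := card_eq_one.1 hcard
  have hγmem : γ ∈ (insert α A + insert β B) \ (A + B) := by rw [hγ]; exact mem_singleton_self γ
  refine ⟨γ, (mem_sdiff.1 hγmem).2, ?_⟩
  rw [insert_eq γ (A + B), ← hγ, sdiff_union_of_subset hsub]

/-! ### Proposition 2.1 (i) inside a pair of `K`-cosets -/

/-- Proposition 2.1 (i) «if `|A| + |B| ≥ |G| + 1` then `A + B = G`» applied «with `G = K`» to slices:
if `X ⊆ a₀ + K`, `Y ⊆ b₀ + K` and `|X| + |Y| > |K|`, then every `z ∈ a₀ + b₀ + K` lies in `X + Y`.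
[cite: Grynkiewicz2009, Prop 2.1 (i) and Cor 4.2 (proof, p. 12)] -/
theorem mem_add_of_card_lt {K : AddSubgroup G} {Kf X Y : Finset G} (hKf : ∀ g, g ∈ Kf ↔ g ∈ K)
    {a₀ b₀ z : G} (hX : ∀ x ∈ X, x - a₀ ∈ K) (hY : ∀ y ∈ Y, y - b₀ ∈ K)
    (hz : z - (a₀ + b₀) ∈ K) (hcard : #Kf < #X + #Y) : z ∈ X + Y := by
  have hXs : X ⊆ a₀ +ᵥ Kf := fun x hx =>
    mem_vadd_finset.2 ⟨x - a₀, (hKf _).2 (hX x hx), by rw [vadd_eq_add, add_sub_cancel]⟩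
  have hYs : Y.image (fun y => z - y) ⊆ a₀ +ᵥ Kf := by
    intro x hx
    obtain ⟨y, hy, rfl⟩ := mem_image.1 hx
    refine mem_vadd_finset.2 ⟨z - y - a₀, (hKf _).2 ?_, by rw [vadd_eq_add, add_sub_cancel]⟩
    have : z - y - a₀ = (z - (a₀ + b₀)) - (y - b₀) := by abel
    rw [this]
    exact K.sub_mem hz (hY y hy)
  have hinj : Set.InjOn (fun y => z - y) ↑Y := fun y _ y' _ h => sub_right_injective h
  have hlt : #(a₀ +ᵥ Kf) < #X + #(Y.image fun y => z - y) := by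
    rw [card_vadd_finset, card_image_of_injOn hinj]; exact hcard
  obtain ⟨x, hx⟩ := inter_nonempty_of_card_lt_card_add_card hXs hYs hlt
  rw [mem_inter, mem_image] at hx
  obtain ⟨hxX, y, hy, rfl⟩ := hx
  exact mem_add.2 ⟨z - y, hxX, y, hy, sub_add_cancel z y⟩

/-! ### Kneser with equality: `|K| − 1` holes in `A′` and `B′` -/

/-- For a critical pair (`|A′ + B′| = |A′| + |B′| − 1`) with `K = H(A′ + B′)`, Kneser's theorem
`|A′ + K| + |B′ + K| ≤ |A′ + B′| + |K|` holds with EQUALITY (all three cardinalities are multiples of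
`|K|`, and strict inequality by a whole `|K|` would give `|A′| + |B′| ≤ |A′ + B′|`) — «there are exactly …
holes»: `|K| − 1` of them in `A′` and `B′` together. [cite: Grynkiewicz2009, Cor 4.2 (proof, p. 12)] -/
theorem card_add_addStab_add_eq {A' B' : Finset G} (hA' : A'.Nonempty) (hB' : B'.Nonempty)
    (hcrit : #(A' + B') + 1 = #A' + #B') :
    #(A' + (A' + B').addStab) + #(B' + (A' + B').addStab) = #(A' + B') + #(A' + B').addStab := by
  set Kf := (A' + B').addStab with hKf
  have hKne : Kf.Nonempty := (hA'.add hB').addStab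
  have hkn := add_kneser A' B'
  rw [← hKf] at hkn
  obtain ⟨p, hp⟩ := card_addStab_dvd_card_add_addStab A' (A' + B')
  obtain ⟨q, hq⟩ := card_addStab_dvd_card_add_addStab B' (A' + B')
  obtain ⟨s, hs⟩ := card_addStab_dvd_card (A' + B')
  rw [← hKf] at hp hq hs
  have h1 : #A' ≤ #(A' + Kf) := card_le_card_add_right hKne
  have h2 : #B' ≤ #(B' + Kf) := card_le_card_add_right hKne
  rw [hp, hq, hs] at hkn ⊢
  rw [hp] at h1
  rw [hq] at h2
  rw [hs] at hcrit
  have hk : 0 < #Kf := card_pos.2 hKne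
  -- `p + q ≤ s + 1` (Kneser) and `p + q > s` (else `|A′| + |B′| ≤ |A′ + B′|`)
  have hle : p + q ≤ s + 1 := by
    by_contra h
    push Not at h
    have : #Kf * (s + 2) ≤ #Kf * (p + q) := Nat.mul_le_mul_left _ (by omega)
    nlinarith
  have hge : s + 1 ≤ p + q := by
    by_contra h
    push Not at h
    have : #Kf * (p + q) ≤ #Kf * s := Nat.mul_le_mul_left _ (by omega)
    nlinarith
  have : p + q = s + 1 := le_antisymm hle hge
  rw [show #Kf * p + #Kf * q = #Kf * (p + q) by ring, this]
  ring

/-- The coset of the added point still meets the original set: with `K = H(A′ + B′)` nontrivial and the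
hole count of `card_add_addStab_add_eq`, `A + K = A′ + K` — otherwise `A` and `B′` would be `K`-periodic
and `β` could be added to `B` without changing `A + B`, against non-extendibility («there are exactly
`|K| + 1` holes in `A` and `B`»). [cite: Grynkiewicz2009, Cor 4.2 (proof, p. 12)] -/
theorem add_addStab_eq_insert_add {K : AddSubgroup G} {Kf A B : Finset G} {α β : G}
    (hKf : ∀ g, g ∈ Kf ↔ g ∈ K) (hk : 2 ≤ #Kf) (hKK : Kf + Kf = Kf)
    (hcount : #(insert α A + Kf) + #(insert β B + Kf) = #A + #B + 1 + #Kf)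
    (hβ : β ∉ B) (hneB : IsNonExtendible B A) : A + Kf = insert α A + Kf := by
  have hKne : Kf.Nonempty := card_pos.1 (by omega)
  by_contra hne
  -- `α ∉ A + K`, so `A′ + K = (A + K) ⊔ (α + K)`
  have hαAK : α ∉ A + Kf := by
    intro hα
    apply hne
    refine Subset.antisymm (add_subset_add_right (subset_insert α A)) ?_
    intro x hx
    obtain ⟨a, ha, g, hg, rfl⟩ := mem_add.1 hx
    rw [mem_insert] at ha
    rcases ha with rfl | ha
    · have : a + g ∈ A + Kf + Kf := add_mem_add hα hg
      rwa [add_assoc, hKK] at this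
    · exact add_mem_add ha hg
  have hdisj : Disjoint (A + Kf) (α +ᵥ Kf) := by
    rw [disjoint_left]
    intro x hx hx'
    obtain ⟨a, ha, g, hg, rfl⟩ := mem_add.1 hx
    obtain ⟨g', hg', heq⟩ := mem_vadd_finset.1 hx'
    rw [vadd_eq_add] at heq
    apply hαAK
    have : α = a + (g - g') := by rw [← add_sub_assoc, ← heq, add_sub_cancel_right]
    rw [this]
    exact add_mem_add ha ((hKf _).2 (K.sub_mem ((hKf _).1 hg) ((hKf _).1 hg')))
  have hunion : insert α A + Kf = (A + Kf) ∪ (α +ᵥ Kf) := by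
    rw [insert_eq, union_add, union_comm]
    congr 1
    ext x
    rw [mem_add, mem_vadd_finset]
    constructor
    · rintro ⟨a, ha, g, hg, rfl⟩
      rw [mem_singleton] at ha
      rw [ha]
      exact ⟨g, hg, rfl⟩
    · rintro ⟨g, hg, rfl⟩
      exact ⟨α, mem_singleton_self α, g, hg, rfl⟩
  have hcardA' : #(insert α A + Kf) = #(A + Kf) + #Kf := by
    rw [hunion, card_union_of_disjoint hdisj, card_vadd_finset]
  have h1 : #A ≤ #(A + Kf) := card_le_card_add_right hKne
  have h2 : #(insert β B) ≤ #(insert β B + Kf) := card_le_card_add_right hKne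
  rw [card_insert_of_notMem hβ] at h2
  rw [hcardA'] at hcount
  -- hence `A + K = A` and `B′ + K = B′`
  have hAK : A + Kf = A := (eq_of_subset_of_card_le (subset_add_left A ((hKf 0).2 K.zero_mem)
    |> fun h => h) (by omega)).symm
  have hB'K : insert β B + Kf = insert β B :=
    (eq_of_subset_of_card_le (subset_add_left _ ((hKf 0).2 K.zero_mem))
      (by rw [card_insert_of_notMem hβ]; omega)).symm
  -- and `β` extends `B`: `(B ∪ {β}) + A = B + A`
  obtain ⟨g, hg, hg0⟩ := exists_mem_ne hk (0 : G)
  apply hneB β hβ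
  refine Subset.antisymm ?_ (add_subset_add_right (subset_insert β B))
  intro x hx
  obtain ⟨b, hb, a, ha, rfl⟩ := mem_add.1 hx
  rw [mem_insert] at hb
  rcases hb with rfl | hb
  · -- `β + a = (β + g) + (a − g)` with `β + g ∈ B` and `a − g ∈ A`
    have hβg : b + g ∈ insert b B := by
      rw [← hB'K]; exact add_mem_add (mem_insert_self b B) hg
    rw [mem_insert] at hβg
    rcases hβg with h | hβgB
    · exact absurd (by simpa using h) hg0
    · have hag : a - g ∈ A := by
        rw [← hAK, sub_eq_add_neg]
        exact add_mem_add ha ((hKf _).2 (K.neg_mem ((hKf _).1 hg)))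
      have : b + a = (b + g) + (a - g) := by abel
      rw [this]
      exact add_mem_add hβgB hag
  · exact add_mem_add hb ha

/-! ### The two extendibility constructions (print p. 12) -/

/-- «Thus if the last remaining hole is not also in either `A_{a₀}` or `B_{b₀}`, then adding it to either
`A` or `B` will contradict the non-extendibility of `(A, B)`»: a hole `h` of `A` outside the coset
`a₀ + K`, when `B` has no holes outside `b₀ + K` (where `γ ∈ a₀ + b₀ + K`, `γ ∉ A + B` and
`A + B + K ⊆ (A + B) ∪ {γ}`), satisfies `h + B ⊆ A + B`.
[cite: Grynkiewicz2009, Cor 4.2 (proof, p. 12)] -/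
theorem false_of_hole_outside {K : AddSubgroup G} {Kf A B : Finset G} {γ a₀ b₀ h : G}
    (hKf : ∀ g, g ∈ Kf ↔ g ∈ K) (hCK : A + B + Kf ⊆ insert γ (A + B)) (hγ : γ ∉ A + B)
    (hc : a₀ + b₀ - γ ∈ K) (hhA : h ∈ A + Kf) (hh : h ∉ A) (hha₀ : h - a₀ ∉ K)
    (hHB : ∀ y ∈ B + Kf, y - b₀ ∉ K → y ∈ B) (hneA : IsNonExtendible A B) : False := by
  apply hneA h hh
  refine Subset.antisymm ?_ (add_subset_add_right (subset_insert h A))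
  intro x hx
  obtain ⟨a, ha, b, hb, rfl⟩ := mem_add.1 hx
  rw [mem_insert] at ha
  rcases ha with rfl | ha
  · obtain ⟨a₁, ha₁, g₁, hg₁, rfl⟩ := mem_add.1 hhA
    have hmem : a₁ + g₁ + b ∈ insert γ (A + B) := by
      apply hCK
      rw [add_right_comm a₁ g₁ b]
      exact add_mem_add (add_mem_add ha₁ hb) hg₁
    rw [mem_insert] at hmem
    rcases hmem with heq | hmem
    · exfalso
      by_cases hbb₀ : b - b₀ ∈ K
      · apply hha₀
        have : a₁ + g₁ - a₀ = -(a₀ + b₀ - γ) - (b - b₀) := by rw [← heq]; abel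
        rw [this]
        exact K.sub_mem (K.neg_mem hc) hbb₀
      · have hbg : b + g₁ ∈ B := by
          refine hHB _ (add_mem_add hb hg₁) fun hK => hbb₀ ?_
          have : b - b₀ = (b + g₁ - b₀) - g₁ := by abel
          rw [this]
          exact K.sub_mem hK ((hKf _).1 hg₁)
        apply hγ
        rw [← heq, add_assoc, add_comm g₁ b]
        exact add_mem_add ha₁ hbg
    · exact hmem
  · exact add_mem_add ha hb

/-- The type-(III) construction: «there are exactly `|H| − |B₀|` elements `x ∈ A₀ + H` such that
`γ ∉ x + B₀`.  Since `|A₀| < |H| − |B₀|`, it follows that there must be at least one such `x` [outside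
`A₀`], whence adding `x` contradicts the non-extendibility of `(A, B)`» — with the slices
`X = A ∩ (a₀ + K)`, `Y = B ∩ (b₀ + K)`, `γ ∈ a₀ + b₀ + K`, `A + B + K ⊆ (A + B) ∪ {γ}` and
`|X| + |Y| ≤ |K| − 1`. [cite: Grynkiewicz2009, Cor 4.2 (proof, p. 12)] -/
theorem false_of_slices_small {K : AddSubgroup G} {Kf A B X Y : Finset G} {γ a₀ b₀ : G}
    (hKf : ∀ g, g ∈ Kf ↔ g ∈ K) (hCK : A + B + Kf ⊆ insert γ (A + B))
    (ha₀ : a₀ ∈ A) (hc : a₀ + b₀ - γ ∈ K) (hX : ∀ x, x ∈ X ↔ x ∈ A ∧ x - a₀ ∈ K)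
    (hY : ∀ y, y ∈ Y ↔ y ∈ B ∧ y - b₀ ∈ K) (hsmall : #X + #Y + 1 ≤ #Kf)
    (hneA : IsNonExtendible A B) : False := by
  set S := (a₀ +ᵥ Kf) \ Y.image (fun y => γ - y) with hS
  have hScard : #X + 1 ≤ #S := by
    have h1 := le_card_sdiff (Y.image fun y => γ - y) (a₀ +ᵥ Kf)
    have h2 : #(Y.image fun y => γ - y) ≤ #Y := card_image_le
    rw [card_vadd_finset] at h1
    rw [hS]
    omega
  have hSX : ¬ S ⊆ X := fun h => absurd (card_le_card h) (by omega)
  rw [not_subset] at hSX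
  obtain ⟨x, hxS, hxX⟩ := hSX
  rw [hS, mem_sdiff, mem_vadd_finset] at hxS
  obtain ⟨⟨g, hg, rfl⟩, hxY⟩ := hxS
  rw [vadd_eq_add] at hxX hxY
  have hxA : a₀ + g ∉ A := fun h => hxX ((hX _).2 ⟨h, by rw [add_sub_cancel_left]; exact (hKf g).1 hg⟩)
  apply hneA _ hxA
  refine Subset.antisymm ?_ (add_subset_add_right (subset_insert _ A))
  intro z hz
  obtain ⟨a, ha, b, hb, rfl⟩ := mem_add.1 hz
  rw [mem_insert] at ha
  rcases ha with rfl | ha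
  · have hmem : a₀ + g + b ∈ insert γ (A + B) := by
      apply hCK
      rw [add_right_comm a₀ g b]
      exact add_mem_add (add_mem_add ha₀ hb) hg
    rw [mem_insert] at hmem
    rcases hmem with heq | hmem
    · exfalso
      apply hxY
      refine mem_image.2 ⟨b, (hY b).2 ⟨hb, ?_⟩, by rw [← heq, add_sub_cancel_right]⟩
      have : b - b₀ = -(a₀ + b₀ - γ) - g := by rw [← heq]; abel
      rw [this]
      exact K.sub_mem (K.neg_mem hc) ((hKf g).1 hg)
    · exact hmem
  · exact add_mem_add ha hb

/-! ### Corollary 4.2, first assertion -/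

/-- **Corollary 4.2, first assertion, in aperiodic form.**  Let `A, B` be finite subsets of an abelian
group with `|A + B| = |A| + |B|`, `(A, B)` non-extendible (print adds «nonempty»; not needed), and
suppose (17):
`|(A ∪ {α}) + (B ∪ {β})| = |A ∪ {α}| + |B ∪ {β}| − 1`.  Then `(A ∪ {α}) + (B ∪ {β})` is aperiodic.
(Print: «`A′ + B′` cannot be periodic without a unique expression element»; the printed proof, followed
here, does not use the unique-expression clause — see the module docstring.)
[cite: Grynkiewicz2009, Cor 4.2 (first assertion), proof pp. 11–12] -/
theorem addStab_insert_add_insert_eq {A B : Finset G} {α β : G}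
    (hAB : #(A + B) = #A + #B) (hneA : IsNonExtendible A B) (hneB : IsNonExtendible B A)
    (h17 : #(insert α A + insert β B) + 1 = #(insert α A) + #(insert β B)) :
    (insert α A + insert β B).addStab = {0} := by
  obtain ⟨hα, hβ⟩ := notMem_of_seventeen hAB hneA hneB h17
  obtain ⟨γ, hγ, hC'⟩ := exists_insert_eq_of_seventeen hAB hα hβ h17
  set A' := insert α A with hA'def
  set B' := insert β B with hB'def
  set C' := A' + B' with hC'def
  set Kf := C'.addStab with hKfdef
  have hA'ne : A'.Nonempty := insert_nonempty α A
  have hB'ne : B'.Nonempty := insert_nonempty β B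
  have hC'ne : C'.Nonempty := hA'ne.add hB'ne
  have hKne : Kf.Nonempty := hC'ne.addStab
  by_contra hper
  -- the maximal period group `K = H(A′ + B′)`, nontrivial
  let K : AddSubgroup G := AddAction.stabilizer G (C' : Set G)
  have hKf : ∀ g, g ∈ Kf ↔ g ∈ K := fun g => by
    rw [hKfdef, mem_addStab hC'ne, AddAction.mem_stabilizer_iff, ← Finset.coe_vadd_finset,
      Finset.coe_inj]
  have hk : 2 ≤ #Kf := by
    by_contra hlt
    push Not at hlt
    have h1 : #Kf = 1 := le_antisymm (by omega) (card_pos.2 hKne)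
    obtain ⟨g, hg⟩ := card_eq_one.1 h1
    have h0 : (0 : G) ∈ Kf := (hKf 0).2 K.zero_mem
    rw [hg, mem_singleton] at h0
    rw [← h0] at hg
    exact hper hg
  have hKK : Kf + Kf = Kf := addStab_add_addStab C'
  -- `|K| − 1` holes in `A′`, `B′`; `|K| + 1` holes in `A`, `B`
  have hcrit : #C' + 1 = #A' + #B' := h17
  have hcount := card_add_addStab_add_eq hA'ne hB'ne hcrit
  rw [← hC'def, ← hKfdef] at hcount
  have hC'card : #C' = #A + #B + 1 := by
    rw [hA'def, hB'def, card_insert_of_notMem hα, card_insert_of_notMem hβ] at hcrit; omega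
  rw [hC'card] at hcount
  have hAK : A + Kf = A' + Kf := add_addStab_eq_insert_add hKf hk hKK hcount hβ hneB
  have hBK : B + Kf = B' + Kf :=
    add_addStab_eq_insert_add hKf hk hKK (by rw [← hA'def, ← hB'def]; omega) hα hneA
  rw [← hAK, ← hBK] at hcount
  -- `A + B + K ⊆ A′ + B′ = (A + B) ∪ {γ}`
  have hCK : A + B + Kf ⊆ insert γ (A + B) := by
    rw [← hC']
    calc A + B + Kf ⊆ C' + Kf := add_subset_add_right (add_subset_add (subset_insert α A)
        (subset_insert β B))
      _ = C' := add_addStab C'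
  -- «there must exist `a₀ ∈ A` and `b₀ ∈ B` … with `γ ∈ A_{a₀} + B_{b₀} + K`»
  obtain ⟨g, hg, hg0⟩ := exists_mem_ne hk (0 : G)
  have hγg : γ + g ∈ A + B := by
    have h1 : γ + g ∈ C' := by
      have : g +ᵥ C' = C' := (mem_addStab hC'ne).1 hg
      rw [← this, hC']
      exact mem_vadd_finset.2 ⟨γ, mem_insert_self γ _, add_comm g γ⟩
    rw [hC', mem_insert] at h1
    rcases h1 with h1 | h1
    · exact absurd (by simpa using h1) hg0
    · exact h1
  obtain ⟨a₀, ha₀, b₀, hb₀, hab⟩ := mem_add.1 hγg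
  have hc : a₀ + b₀ - γ ∈ K := by rw [hab, add_sub_cancel_left]; exact (hKf g).1 hg
  have hc' : b₀ + a₀ - γ ∈ K := by rwa [add_comm b₀ a₀]
  -- the slices and the holes
  set X := A.filter (fun x => x - a₀ ∈ Kf) with hXdef
  set Y := B.filter (fun y => y - b₀ ∈ Kf) with hYdef
  have hX : ∀ x, x ∈ X ↔ x ∈ A ∧ x - a₀ ∈ K := fun x => by rw [hXdef, mem_filter, hKf]
  have hY : ∀ y, y ∈ Y ↔ y ∈ B ∧ y - b₀ ∈ K := fun y => by rw [hYdef, mem_filter, hKf]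
  -- Proposition 2.1: `|X| + |Y| ≤ |K|`
  have hXY : #X + #Y ≤ #Kf := by
    by_contra hlt
    push Not at hlt
    have := mem_add_of_card_lt hKf (fun x hx => ((hX x).1 hx).2) (fun y hy => ((hY y).1 hy).2)
      (show γ - (a₀ + b₀) ∈ K by
        have := K.neg_mem hc; rwa [neg_sub] at this) hlt
    exact hγ (add_subset_add (filter_subset _ A) (filter_subset _ B) this)
  by_cases hsmall : #X + #Y + 1 ≤ #Kf
  · exact false_of_slices_small hKf hCK ha₀ hc hX hY hsmall hneA
  have hXYk : #X + #Y = #Kf := by omega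
  -- hole sets: `HA = (A + K) ∖ A`, split by the coset `a₀ + K`
  set HA := (A + Kf) \ A with hHAdef
  set HB := (B + Kf) \ B with hHBdef
  have hAsub : A ⊆ A + Kf := subset_add_left A ((hKf 0).2 K.zero_mem)
  have hBsub : B ⊆ B + Kf := subset_add_left B ((hKf 0).2 K.zero_mem)
  have hHAcard : #HA + #A = #(A + Kf) := card_sdiff_add_card_eq_card hAsub
  have hHBcard : #HB + #B = #(B + Kf) := card_sdiff_add_card_eq_card hBsub
  -- holes inside the cosets `a₀ + K`, `b₀ + K`
  have hinA : #(HA.filter fun y => y - a₀ ∈ Kf) + #X = #Kf := by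
    rw [← card_vadd_finset a₀ Kf, ← card_union_of_disjoint]
    · congr 1
      ext y
      rw [mem_union, mem_filter, hHAdef, mem_sdiff, hX, hKf, mem_vadd_finset]
      constructor
      · rintro (⟨⟨-, -⟩, hy⟩ | ⟨-, hy⟩)
        · exact ⟨y - a₀, (hKf _).2 hy, by rw [vadd_eq_add, add_sub_cancel]⟩
        · exact ⟨y - a₀, (hKf _).2 hy, by rw [vadd_eq_add, add_sub_cancel]⟩
      · rintro ⟨g', hg', rfl⟩
        rw [vadd_eq_add, add_sub_cancel_left]
        by_cases hyA : a₀ + g' ∈ A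
        · exact Or.inr ⟨hyA, (hKf _).1 hg'⟩
        · exact Or.inl ⟨⟨add_mem_add ha₀ hg', hyA⟩, (hKf _).1 hg'⟩
    · rw [disjoint_left]
      intro y hy hyX
      rw [mem_filter, hHAdef, mem_sdiff] at hy
      exact hy.1.2 ((hX y).1 hyX).1
  have hinB : #(HB.filter fun y => y - b₀ ∈ Kf) + #Y = #Kf := by
    rw [← card_vadd_finset b₀ Kf, ← card_union_of_disjoint]
    · congr 1
      ext y
      rw [mem_union, mem_filter, hHBdef, mem_sdiff, hY, hKf, mem_vadd_finset]
      constructor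
      · rintro (⟨⟨-, -⟩, hy⟩ | ⟨-, hy⟩)
        · exact ⟨y - b₀, (hKf _).2 hy, by rw [vadd_eq_add, add_sub_cancel]⟩
        · exact ⟨y - b₀, (hKf _).2 hy, by rw [vadd_eq_add, add_sub_cancel]⟩
      · rintro ⟨g', hg', rfl⟩
        rw [vadd_eq_add, add_sub_cancel_left]
        by_cases hyB : b₀ + g' ∈ B
        · exact Or.inr ⟨hyB, (hKf _).1 hg'⟩
        · exact Or.inl ⟨⟨add_mem_add hb₀ hg', hyB⟩, (hKf _).1 hg'⟩
    · rw [disjoint_left]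
      intro y hy hyY
      rw [mem_filter, hHBdef, mem_sdiff] at hy
      exact hy.1.2 ((hY y).1 hyY).1
  have hsplitA := card_filter_add_card_filter_not (s := HA) (fun y => y - a₀ ∈ Kf)
  have hsplitB := card_filter_add_card_filter_not (s := HB) (fun y => y - b₀ ∈ Kf)
  -- exactly one hole outside the two cosets
  have hout : #(HA.filter fun y => ¬ (y - a₀ ∈ Kf)) + #(HB.filter fun y => ¬ (y - b₀ ∈ Kf)) = 1 := by
    omega
  rcases Nat.eq_zero_or_pos #(HA.filter fun y => ¬ (y - a₀ ∈ Kf)) with hA0 | hApos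
  · -- the hole is in `B`: symmetric construction
    have hB1 : #(HB.filter fun y => ¬ (y - b₀ ∈ Kf)) = 1 := by omega
    obtain ⟨h, hh⟩ := card_eq_one.1 hB1
    have hhmem : h ∈ HB.filter fun y => ¬ (y - b₀ ∈ Kf) := by rw [hh]; exact mem_singleton_self h
    rw [mem_filter, hHBdef, mem_sdiff, hKf] at hhmem
    refine false_of_hole_outside (A := B) (B := A) hKf (by rwa [add_comm B A]) (by rwa [add_comm B A])
      hc' hhmem.1.1 hhmem.1.2 hhmem.2 (fun y hy hya₀ => ?_) hneB
    by_contra hyA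
    have : y ∈ HA.filter fun y => ¬ (y - a₀ ∈ Kf) := by
      rw [mem_filter, hHAdef, mem_sdiff, hKf]; exact ⟨⟨hy, hyA⟩, hya₀⟩
    rw [card_eq_zero.1 hA0] at this
    exact notMem_empty y this
  · have hA1 : #(HA.filter fun y => ¬ (y - a₀ ∈ Kf)) = 1 := by omega
    have hB0 : #(HB.filter fun y => ¬ (y - b₀ ∈ Kf)) = 0 := by omega
    obtain ⟨h, hh⟩ := card_eq_one.1 hA1
    have hhmem : h ∈ HA.filter fun y => ¬ (y - a₀ ∈ Kf) := by rw [hh]; exact mem_singleton_self h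
    rw [mem_filter, hHAdef, mem_sdiff, hKf] at hhmem
    refine false_of_hole_outside hKf hCK hγ hc hhmem.1.1 hhmem.1.2 hhmem.2 (fun y hy hyb₀ => ?_) hneA
    by_contra hyB
    have : y ∈ HB.filter fun y => ¬ (y - b₀ ∈ Kf) := by
      rw [mem_filter, hHBdef, mem_sdiff, hKf]; exact ⟨⟨hy, hyB⟩, hyb₀⟩
    rw [card_eq_zero.1 hB0] at this
    exact notMem_empty y this

/-- **Corollary 4.2, first assertion, as printed** («If `(A, B)` is non-extendible, then `A′ + B′` cannot
be periodic without a unique expression element»), in the form of the KST hypothesis of the tree's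
`exists_isKempermanDecompI`: `A′ + B′` is aperiodic or has an element with a unique expression.
[cite: Grynkiewicz2009, Cor 4.2 (first assertion)] -/
theorem not_isPeriodic_or_exists_unique_of_seventeen {A B : Finset G} {α β : G}
    (hAB : #(A + B) = #A + #B) (hneA : IsNonExtendible A B) (hneB : IsNonExtendible B A)
    (h17 : #(insert α A + insert β B) + 1 = #(insert α A) + #(insert β B)) :
    ¬ IsPeriodic (insert α A + insert β B) ∨
      ∃ c, (insert α A).addConvolution (insert β B) c = 1 := by
  refine Or.inl fun hper => ?_
  exact (isPeriodic_iff_addStab_ne ((insert_nonempty α A).add (insert_nonempty β B))).1 hper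
    (addStab_insert_add_insert_eq hAB hneA hneB h17)

end Literature.Combinatorics.Additive.Grynkiewicz2009
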